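import Literature.Barriers.QuantumFields.NoClassicalGlueballs
import Literature.Barriers.QuantumFields.HaagTheorem
import Literature.Analysis.FluidPDE.SpaceTimeCalculus
import HarnessLib

/-!
# No classical glueballs: time slices and the transport lemma (proofs, part 2)

Sibling proof file of `Literature/Barriers/QuantumFields/NoClassicalGlueballs.lean` (second of the
files discharging `ColemanNoClassicalGlueballs`, Coleman 1977). It provides the calculus on the
time slices `y ↦ (t, y)` of `ℝ^{1+3}` (`Literature.MathematicalPhysics.QuantumLattice.ofTimeSpace`)
and the one analytic lemma behind Coleman's (12) and behind energy conservation: for smooth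
densities `u`, `J_j` on space-time obeying a local conservation law `∂₀ u = Σ_j ∂_j J_j` and a
compactly supported smooth weight `ψ` on `ℝ³`,

  `d/dt ∫ ψ(y) u(t, y) dy = − Σ_j ∫ ∂_jψ(y) J_j(t, y) dy`

(`hasDerivAt_integral_mul_slice`: differentiation under the integral sign, then integration by
parts on the whole space — "`∂₀F = ∫ θ₀₀ + ∮ …`", Coleman (12), with a smooth cutoff in place of
the sharp ball so that the surface term becomes a bulk term supported in the transition shell).

## Mathlib / tree search

Everything is a thin layer over Mathlib's integration by parts on finite-dimensional spaces
(`integral_mul_fderiv_eq_neg_fderiv_mul_of_integrable`; the tree's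
`FluidPDE.integral_fderiv_apply_mul_eq_neg` / `integral_fderiv_mul_eq_neg_of_hasCompactSupport`
are the same rearrangement in other import closures) and the tree's `Literature.Analysis.FluidPDE`
calculus: `hasDerivAt_integral_of_support_subset` (parametric integrals with compact spatial
support, `SpaceTimeCalculus`). The affine structure `ofTimeSpace t y = t • e₀ + spaceEmbed 3 y`
uses the spatial embedding `spaceEmbed` of `HaagTheorem.lean`.

## References

* S. Coleman, *There are no classical glueballs*, Commun. Math. Phys. 55 (1977) 113–116, §2
  (11)–(12) [Coleman1977].
* R. T. Glassey, W. A. Strauss, Commun. Math. Phys. 65 (1979) 1–13, §3 ("if (e) is integrated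
  over all space and the solution vanishes at infinity … we get the conservation of energy")
  [GlasseyStrauss1979].
-/

noncomputable section

open scoped ContDiff
open MeasureTheory Set Filter Topology Function

namespace Literature.Barriers.QuantumFields

open Literature.MathematicalPhysics.QuantumLattice Literature.Analysis.FluidPDE

/-! ### The time slices `y ↦ (t, y)` -/

/-- `(t, y) = t e₀ + (0, y)`. [folklore] -/
theorem ofTimeSpace_eq_smul_add (t : ℝ) (y : EuclideanSpace ℝ (Fin 3)) :
    ofTimeSpace t y = t • unitVec 0 + spaceEmbed 3 y := by
  ext i
  refine Fin.cases ?_ (fun j => ?_) i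
  · simp
  · simp [Fin.succ_ne_zero]

/-- The spatial unit vectors: `spaceEmbed 3 (δ_j) = e_{j+1}`. [folklore] -/
theorem spaceEmbed_single (j : Fin 3) :
    spaceEmbed 3 (EuclideanSpace.single j 1) = unitVec j.succ := by
  ext i
  refine Fin.cases ?_ (fun k => ?_) i
  · simp [(Fin.succ_ne_zero j).symm]
  · by_cases h : k = j
    · subst h; simp
    · simp [h, (Fin.succ_injective 3).ne h]

/-- The time lines `s ↦ (s, y)` have velocity `e₀`. [folklore] -/
theorem hasDerivAt_ofTimeSpace (t : ℝ) (y : EuclideanSpace ℝ (Fin 3)) :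
    HasDerivAt (fun s => ofTimeSpace s y) (unitVec 0) t := by
  have h : (fun s => ofTimeSpace s y) = fun s => s • unitVec 0 + spaceEmbed 3 y :=
    funext fun s => ofTimeSpace_eq_smul_add s y
  rw [h]
  simpa using ((hasDerivAt_id t).smul_const (unitVec 0)).add_const (spaceEmbed 3 y)

/-- The slices `y ↦ (t, y)` are affine with linear part `spaceEmbed 3`. [folklore] -/
theorem hasFDerivAt_ofTimeSpace (t : ℝ) (y : EuclideanSpace ℝ (Fin 3)) :
    HasFDerivAt (fun z => ofTimeSpace t z) (spaceEmbed 3) y := by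
  have h : (fun z => ofTimeSpace t z) = fun z => t • unitVec 0 + spaceEmbed 3 z :=
    funext fun z => ofTimeSpace_eq_smul_add t z
  rw [h]
  exact (spaceEmbed 3).hasFDerivAt.const_add _

/-- `(t, y) ↦ (t, y)` is smooth (it is linear in `(t, y)`). [folklore] -/
theorem contDiff_ofTimeSpace_uncurry {n : WithTop ℕ∞} :
    ContDiff ℝ n fun p : ℝ × EuclideanSpace ℝ (Fin 3) => ofTimeSpace p.1 p.2 := by
  have h : (fun p : ℝ × EuclideanSpace ℝ (Fin 3) => ofTimeSpace p.1 p.2) =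
      fun p => p.1 • unitVec 0 + spaceEmbed 3 p.2 :=
    funext fun p => ofTimeSpace_eq_smul_add p.1 p.2
  rw [h]
  exact (contDiff_fst.smul contDiff_const).add ((spaceEmbed 3).contDiff.comp contDiff_snd)

/-- The slice `y ↦ (t, y)` is smooth. [folklore] -/
theorem contDiff_ofTimeSpace_right (t : ℝ) {n : WithTop ℕ∞} :
    ContDiff ℝ n fun y : EuclideanSpace ℝ (Fin 3) => ofTimeSpace t y :=
  contDiff_ofTimeSpace_uncurry.comp (contDiff_prodMk_right t)

/-- **Chain rule in time**: `d/ds u(s, y) = ∂₀u (s, y)`. [folklore] -/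
theorem hasDerivAt_comp_ofTimeSpace {F : Type*} [NormedAddCommGroup F] [NormedSpace ℝ F]
    {u : SpaceTime 3 → F} (t : ℝ) (y : EuclideanSpace ℝ (Fin 3))
    (hu : DifferentiableAt ℝ u (ofTimeSpace t y)) :
    HasDerivAt (fun s => u (ofTimeSpace s y)) (fderiv ℝ u (ofTimeSpace t y) (unitVec 0)) t := by
  have h := hu.hasFDerivAt.comp_hasDerivAt t (hasDerivAt_ofTimeSpace t y)
  exact h

/-- **Chain rule in space**: `∂_{δ_j} (u(t, ·))(y) = ∂_{j+1} u (t, y)`. [folklore] -/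
theorem fderiv_comp_ofTimeSpace_single {F : Type*} [NormedAddCommGroup F] [NormedSpace ℝ F]
    {u : SpaceTime 3 → F} (t : ℝ) (y : EuclideanSpace ℝ (Fin 3))
    (hu : DifferentiableAt ℝ u (ofTimeSpace t y)) (j : Fin 3) :
    fderiv ℝ (fun z => u (ofTimeSpace t z)) y (EuclideanSpace.single j 1) =
      fderiv ℝ u (ofTimeSpace t y) (unitVec j.succ) := by
  have h : HasFDerivAt (fun z => u (ofTimeSpace t z))
      ((fderiv ℝ u (ofTimeSpace t y)).comp (spaceEmbed 3)) y :=
    hu.hasFDerivAt.comp y (hasFDerivAt_ofTimeSpace t y)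
  rw [h.fderiv, ContinuousLinearMap.coe_comp, Function.comp_apply, spaceEmbed_single]

/-! ### The transport lemma -/

/-- **Integration by parts on a slice**: for `ψ ∈ C¹_c(ℝ³)` and `g ∈ C¹(ℝ³)`,
`∫ ψ ∂_v g = −∫ (∂_v ψ) g` — Mathlib's `integral_mul_fderiv_eq_neg_fderiv_mul_of_integrable`
with the three integrability side conditions discharged by compact support (cf. the tree's
`FluidPDE.integral_fderiv_apply_mul_eq_neg`). [folklore] -/
theorem integral_mul_fderiv_eq_neg {ψ g : EuclideanSpace ℝ (Fin 3) → ℝ} (hψ : ContDiff ℝ 1 ψ)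
    (hψc : HasCompactSupport ψ) (hg : ContDiff ℝ 1 g) (v : EuclideanSpace ℝ (Fin 3)) :
    ∫ y, ψ y * fderiv ℝ g y v = -∫ y, fderiv ℝ ψ y v * g y := by
  refine integral_mul_fderiv_eq_neg_fderiv_mul_of_integrable ?_ ?_ ?_
    (fun y _ => hψ.differentiable one_ne_zero y) (fun y _ => hg.differentiable one_ne_zero y)
  · exact (((hψ.continuous_fderiv one_ne_zero).clm_apply continuous_const).mul hg.continuous)
      |>.integrable_of_hasCompactSupport (hψc.fderiv_apply (𝕜 := ℝ) v).mul_right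
  · exact (hψ.continuous.mul ((hg.continuous_fderiv one_ne_zero).clm_apply continuous_const))
      |>.integrable_of_hasCompactSupport hψc.mul_right
  · exact (hψ.continuous.mul hg.continuous).integrable_of_hasCompactSupport hψc.mul_right

/-- **The transport lemma (Coleman (12) with a smooth cutoff).** Let `u, J₀, J₁, J₂` be smooth
real functions on `ℝ^{1+3}` satisfying the local conservation law `∂₀u = Σ_j ∂_{j+1} J_j`
everywhere, and let `ψ` be a smooth compactly supported weight on `ℝ³`. Then
`t ↦ ∫ ψ(y) u(t, y) dy` is differentiable with derivative `−Σ_j ∫ ∂_jψ(y) J_j(t, y) dy`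
(differentiate under the integral, insert the conservation law, integrate by parts).
[cite: Coleman1977, §2 (11)–(12)] -/
theorem hasDerivAt_integral_mul_slice {u : SpaceTime 3 → ℝ} {J : Fin 3 → SpaceTime 3 → ℝ}
    (hu : ContDiff ℝ ∞ u) (hJ : ∀ j, ContDiff ℝ ∞ (J j))
    (hcons : ∀ x, fderiv ℝ u x (unitVec 0) = ∑ j, fderiv ℝ (J j) x (unitVec j.succ))
    {ψ : EuclideanSpace ℝ (Fin 3) → ℝ} (hψ : ContDiff ℝ ∞ ψ) (hψc : HasCompactSupport ψ) (t : ℝ) :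
    HasDerivAt (fun s => ∫ y, ψ y * u (ofTimeSpace s y))
      (-(∑ j, ∫ y, fderiv ℝ ψ y (EuclideanSpace.single j 1) * J j (ofTimeSpace t y))) t := by
  -- the integrand as a jointly smooth field with compact spatial support
  set Φ : ℝ → EuclideanSpace ℝ (Fin 3) → ℝ := fun s y => ψ y * u (ofTimeSpace s y) with hΦ
  have hΦs : IsSmoothSpaceTimeOn univ Φ := by
    have h : ContDiff ℝ ∞ (uncurry Φ) :=
      (hψ.comp contDiff_snd).mul (hu.comp contDiff_ofTimeSpace_uncurry)
    exact h.contDiffOn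
  have hK : IsCompact (tsupport ψ) := hψc
  have hsupp : ∀ s ∈ (univ : Set ℝ), ∀ y ∉ tsupport ψ, Φ s y = 0 := by
    intro s _ y hy
    simp [hΦ, image_eq_zero_of_notMem_tsupport hy]
  have key := hasDerivAt_integral_of_support_subset (μ := (volume : Measure (EuclideanSpace ℝ (Fin 3))))
    isOpen_univ hΦs hK hsupp (mem_univ t)
  -- the time derivative of the integrand, via the conservation law
  have hderiv : ∀ y, deriv (fun s => Φ s y) t =
      ∑ j, ψ y * fderiv ℝ (fun z => J j (ofTimeSpace t z)) y (EuclideanSpace.single j 1) := by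
    intro y
    have h1 : HasDerivAt (fun s => Φ s y) (ψ y * fderiv ℝ u (ofTimeSpace t y) (unitVec 0)) t :=
      (hasDerivAt_comp_ofTimeSpace t y ((hu.differentiable (by simp)) _)).const_mul (ψ y)
    rw [h1.deriv, hcons, Finset.mul_sum]
    refine Finset.sum_congr rfl fun j _ => ?_
    rw [fderiv_comp_ofTimeSpace_single t y (((hJ j).differentiable (by simp)) _)]
  simp_rw [hderiv] at key
  -- integrate by parts, summand by summand
  have hg : ∀ j, ContDiff ℝ 1 fun z : EuclideanSpace ℝ (Fin 3) => J j (ofTimeSpace t z) := fun j =>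
    ((hJ j).of_le (WithTop.coe_le_coe.mpr le_top)).comp (contDiff_ofTimeSpace_right t)
  have hψ1 : ContDiff ℝ 1 ψ := hψ.of_le (WithTop.coe_le_coe.mpr le_top)
  have hint : ∀ j, Integrable fun y =>
      ψ y * fderiv ℝ (fun z => J j (ofTimeSpace t z)) y (EuclideanSpace.single j 1) := fun j =>
    (hψ.continuous.mul (((hg j).continuous_fderiv one_ne_zero).clm_apply continuous_const))
      |>.integrable_of_hasCompactSupport hψc.mul_right
  rw [integral_finsetSum _ fun j _ => hint j] at key
  have hibp : ∀ j, ∫ y, ψ y * fderiv ℝ (fun z => J j (ofTimeSpace t z)) y (EuclideanSpace.single j 1) =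
      -∫ y, fderiv ℝ ψ y (EuclideanSpace.single j 1) * J j (ofTimeSpace t y) := fun j =>
    integral_mul_fderiv_eq_neg hψ1 hψc (hg j) _
  simp_rw [hibp, Finset.sum_neg_distrib] at key
  exact key

end Literature.Barriers.QuantumFields
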